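import Literature.NumberTheory.EllipticCurves.ModularSymbolsPeriodHomology
import HarnessLib

/-!
# Route `ResidualThetaTransportAtTwo`, crux Kμ⁺ `SignedMuVanishingAtTwoPlus` (stmt-BirchSwinnertonDyer-20689),
# line `birth`, stub `stub_flatMuZeroAtTwo`: THEOREM (R), step (d) — the Hecke–Shimura lemma on period
# functionals: the `p + 1` translates `δⱼ, δ'` of `{∞, γ∞}_{T_p h} = ∑ⱼ {∞, δⱼ∞}_h + {∞, δ'∞}_h` satisfy
# `∏ⱼ d(δⱼ) · d(δ') = d(γ)^{p+1}` in `ZMod N` («`T_p = p + 1` on the Shimura quotient», character form)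

Cell `bsd-wall`, lead `bsd-wall-rtt-p4` g5 (helper for the registered stub `stub_flatMuZeroAtTwo : FlatMuZeroAtTwo` of
`Cruxes/SignedMuVanishingAtTwoPlus/Lines/birth.lean`; THEOREMS ONLY — no `def`, no named fact, no `sorry`; `f`-free:
nothing about any curve or cusp form is asserted; BSD is not proved by this). Source of the argument: lead g4's crux
workfile `Cruxes/SignedMuVanishingAtTwoPlus/FlatCuspSpan.md` §2 (d) (KEY LEMMA: Hecke on the Shimura classes).

* `exists_gamma0_inftyImage_tpB_lowerRight`, `exists_gamma0_inftyImage_tpD_lowerRight`: the tree's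
  `exists_gamma0_inftyImage_tpB/tpD` (`(1 j; 0 p)γ∞` and `diag(p,1)γ∞` are `Γ₀(N)`-translates `δ∞` of `∞`, with
  `δ` written down from the first column via `Gamma0.mkOfCol`) WITH the lower-right entry `d(δ)` controlled in
  `ZMod N`: `d(δ)·a ∈ {1, p}` resp. `d(δ')·a·{1 or p} = 1` (`a` = top-left entry of `γ`; `d(γ)·a = 1`).
* `prod_ite_dvd_add_mul_eq`: for coprime `a, c` exactly one of `a + jc`, `0 ≤ j < p`, is divisible by `p` when
  `p ∤ c`, none when `p ∣ c` (product form).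
* `exists_cuspSymbol_heckeT_lowerRight` (**the Hecke–Shimura lemma**): for a prime `p ∤ N` and `γ ∈ Γ₀(N)` there
  are `δ : Fin p → Γ₀(N)`, `δ'` with `{∞, γ∞}_{T_p h} = ∑ⱼ {∞, δⱼ∞}_h + {∞, δ'∞}_h` for EVERY `h ∈ S₂(Γ₀(N))`
  (exactly the tree's `exists_cuspSymbol_heckeT`, Cremona (2.4.1)–(2.4.2)) AND `∏ⱼ d(δⱼ)·d(δ') = d(γ)^{p+1}`.
  Consequence (used in the sequel file `…CuspSpanHecke`): every character `ψ∘d` of `Γ₀(N)` is `T_p`-Eisenstein,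
  `(ψ∘d)(T_p[γ]) = (p+1)(ψ∘d)[γ]` — Ling–Oesterlé 1991 Thm 6 («`T_p = p+1` on the Shimura subgroup», `p ∤ N`;
  Mazur 1977 II.11.7 for prime level; Ribet), here in `Γ₀(N)`-character form, which the tree did not have (its
  `ShimuraSubgroupHeckeCongruence` file types the `p ∣ N` half only).

References: S. Ling, J. Oesterlé, *The Shimura subgroup of `J₀(N)`*, Astérisque 196–197 (1991), Thm 6
[LingOesterle1991]; B. Mazur, *Modular curves and the Eisenstein ideal*, Publ. IHÉS 47 (1977), II.11.7 [Mazur1977];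
J. E. Cremona, *Algorithms for modular elliptic curves* (1997), §2.4 (2.4.1)–(2.4.2) [CremonaAlgorithms1997];
G. Shimura, *Introduction to the arithmetic theory of automorphic functions* (1971), Prop. 3.36 [Shimura1971].
-/

set_option autoImplicit false
set_option linter.dupNamespace false

noncomputable section

open scoped Classical MatrixGroups ModularForm

open CongruenceSubgroup Literature.NumberTheory.EllipticCurves.ModularForms

namespace Summit.BirchSwinnertonDyer.BirchSwinnertonDyer.Theorems.SignedMuAtTwo


/-! ## The Hecke–Shimura lemma on period functionals: `∏ⱼ d(δⱼ) · d(δ') = d(γ)^{p+1}` -/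

section HeckeShimura

variable {N : ℕ}

/-- The lower-right entry of the tree's `Gamma0.mkOfCol u v` (first column `(u, v)ᵀ`, `N ∣ v`) is a Bézout
coefficient `x` with `x u + y v = 1`. [folklore] -/
theorem exists_mkOfCol_apply_one_one_mul_add (u v : ℤ) (huv : IsCoprime u v) (hv : (N : ℤ) ∣ v) :
    ∃ y : ℤ, ((Gamma0.mkOfCol u v huv hv : Gamma0 N) : SL(2, ℤ)) 1 1 * u + y * v = 1 :=
  ⟨huv.choose_spec.choose, huv.choose_spec.choose_spec⟩

/-- In `ZMod N` the lower-right entry of `Gamma0.mkOfCol u v` is the inverse of `u`: `d · u = 1`. [folklore] -/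
theorem mkOfCol_apply_one_one_mul_eq_one (u v : ℤ) (huv : IsCoprime u v) (hv : (N : ℤ) ∣ v) :
    ((((Gamma0.mkOfCol u v huv hv : Gamma0 N) : SL(2, ℤ)) 1 1 : ℤ) : ZMod N) * (u : ZMod N) = 1 := by
  obtain ⟨y, hy⟩ := exists_mkOfCol_apply_one_one_mul_add (N := N) u v huv hv
  have hv0 : ((v : ℤ) : ZMod N) = 0 := (ZMod.intCast_zmod_eq_zero_iff_dvd v N).mpr hv
  have := congrArg (fun z : ℤ ↦ (z : ZMod N)) hy
  simp only [Int.cast_add, Int.cast_mul, Int.cast_one, hv0, mul_zero, add_zero] at this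
  exact this

/-- For `γ = (a b; c d) ∈ Γ₀(N)`: `d · a = 1` in `ZMod N` (`ad − bc = 1`, `c ≡ 0`). [folklore] -/
theorem gamma0_apply_one_one_mul_apply_zero_zero (γ : Gamma0 N) :
    ((((γ : SL(2, ℤ)) 1 1 : ℤ) : ZMod N)) * ((((γ : SL(2, ℤ)) 0 0 : ℤ) : ZMod N)) = 1 := by
  have hdet := Matrix.det_fin_two (γ : SL(2, ℤ)).1
  rw [(γ : SL(2, ℤ)).2] at hdet
  have hc : ((((γ : SL(2, ℤ)) 1 0 : ℤ) : ZMod N)) = 0 := by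
    have := γ.2
    rw [Gamma0_mem] at this
    exact_mod_cast this
  have := congrArg (fun z : ℤ ↦ (z : ZMod N)) hdet
  simp only [Int.cast_one, Int.cast_sub, Int.cast_mul] at this
  rw [this]
  have h10 : (((γ : SL(2, ℤ)).1 1 0 : ℤ) : ZMod N) = 0 := hc
  rw [h10, mul_zero, sub_zero, mul_comm]

/-- The lower-right entry of `γ ∈ Γ₀(N)` is a unit of `ZMod N`. [folklore] -/
theorem isUnit_gamma0_apply_one_one (γ : Gamma0 N) : IsUnit ((((γ : SL(2, ℤ)) 1 1 : ℤ) : ZMod N)) :=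
  IsUnit.of_mul_eq_one _ (gamma0_apply_one_one_mul_apply_zero_zero γ)

variable {p : ℕ} (hp : p.Prime)
include hp

/-- **`(1 j; 0 p) γ ∞` is a `Γ₀(N)`-translate `δ∞` of `∞`, with control of `d(δ)`** (the tree's
`exists_gamma0_inftyImage_tpB` plus the lower-right entry): for `γ = (a b; c d)`, `δ` has first column
`((a + jc)/p, c)` if `p ∣ a + jc` — then `d(δ) · a = p` in `ZMod N` — and `(a + jc, pc)` otherwise — then
`d(δ) · a = 1`. [folklore] -/
theorem exists_gamma0_inftyImage_tpB_lowerRight (γ : Gamma0 N) (j : ℤ) :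
    ∃ δ : Gamma0 N, ((δ : SL(2, ℤ)) 1 0 = 0 ↔ (γ : SL(2, ℤ)) 1 0 = 0) ∧
      ((γ : SL(2, ℤ)) 1 0 ≠ 0 →
        ((δ : SL(2, ℤ)) 0 0 : ℚ) / ((δ : SL(2, ℤ)) 1 0 : ℚ) =
          (((γ : SL(2, ℤ)) 0 0 : ℚ) / ((γ : SL(2, ℤ)) 1 0 : ℚ) + j) / p) ∧
      ((((δ : SL(2, ℤ)) 1 1 : ℤ) : ZMod N)) * ((((γ : SL(2, ℤ)) 0 0 : ℤ) : ZMod N)) =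
        if (p : ℤ) ∣ (γ : SL(2, ℤ)) 0 0 + j * (γ : SL(2, ℤ)) 1 0 then (p : ZMod N) else 1 := by
  have hp0 : p ≠ 0 := hp.ne_zero
  have hpz : (p : ℤ) ≠ 0 := by exact_mod_cast hp0
  have hpP : Prime (p : ℤ) := Nat.prime_iff_prime_int.mp hp
  set a : ℤ := (γ : SL(2, ℤ)) 0 0
  set c : ℤ := (γ : SL(2, ℤ)) 1 0
  have hac : IsCoprime a c := Matrix.SpecialLinearGroup.isCoprime_col (γ : SL(2, ℤ)) 0
  have hNc : (N : ℤ) ∣ c := dvd_entry_of_mem_Gamma0 N γ.2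
  have hc0 : ((c : ℤ) : ZMod N) = 0 := (ZMod.intCast_zmod_eq_zero_iff_dvd c N).mpr hNc
  have hajc : IsCoprime (a + j * c) c := by
    simpa [mul_comm] using hac.add_mul_right_left j
  by_cases hdvd : (p : ℤ) ∣ a + j * c
  · obtain ⟨u, hu⟩ := hdvd
    have huc : IsCoprime u c := by
      rw [hu, mul_comm] at hajc
      exact hajc.of_mul_left_left
    refine ⟨Gamma0.mkOfCol u c huc hNc, by simp [c], fun hc ↦ ?_, ?_⟩
    · simp only [Gamma0.mkOfCol_apply_zero_zero, Gamma0.mkOfCol_apply_one_zero]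
      have hc' : (c : ℚ) ≠ 0 := by exact_mod_cast hc
      have hp' : (p : ℚ) ≠ 0 := by exact_mod_cast hp0
      have hu' : (a : ℚ) + j * c = p * u := by exact_mod_cast hu
      field_simp
      linear_combination -hu'
    · rw [if_pos ⟨u, hu⟩]
      have h1 := mkOfCol_apply_one_one_mul_eq_one (N := N) u c huc hNc
      have hau : ((a : ℤ) : ZMod N) = (p : ZMod N) * (u : ZMod N) := by
        have := congrArg (fun z : ℤ ↦ (z : ZMod N)) hu
        simp only [Int.cast_add, Int.cast_mul, hc0, mul_zero, add_zero, Int.cast_natCast] at this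
        exact this
      rw [hau, mul_left_comm, h1, mul_one]
  · have hpc : IsCoprime (a + j * c) (p * c) :=
      ((hpP.coprime_iff_not_dvd.mpr hdvd).symm).mul_right hajc
    refine ⟨Gamma0.mkOfCol (a + j * c) (p * c) hpc (hNc.mul_left _), by simp [c, hp0], fun hc ↦ ?_, ?_⟩
    · simp only [Gamma0.mkOfCol_apply_zero_zero, Gamma0.mkOfCol_apply_one_zero]
      have hc' : (c : ℚ) ≠ 0 := by exact_mod_cast hc
      have hp' : (p : ℚ) ≠ 0 := by exact_mod_cast hp0
      push_cast
      field_simp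
    · rw [if_neg hdvd]
      have h1 := mkOfCol_apply_one_one_mul_eq_one (N := N) (a + j * c) (p * c) hpc (hNc.mul_left _)
      have hajc' : (((a + j * c : ℤ)) : ZMod N) = ((a : ℤ) : ZMod N) := by
        push_cast
        rw [hc0, mul_zero, add_zero]
      rwa [hajc'] at h1

/-- **`diag(p, 1) γ ∞ = p · γ∞` is a `Γ₀(N)`-translate `δ'∞` of `∞`, with control of `d(δ')`** (`p ∤ N`; the
tree's `exists_gamma0_inftyImage_tpD` plus the lower-right entry): first column `(a, c/p)` if `p ∣ c` — then
`d(δ') · a = 1` — and `(pa, c)` otherwise — then `d(δ') · a · p = 1`. [folklore] -/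
theorem exists_gamma0_inftyImage_tpD_lowerRight (hpN : ¬ p ∣ N) (γ : Gamma0 N) :
    ∃ δ : Gamma0 N, ((δ : SL(2, ℤ)) 1 0 = 0 ↔ (γ : SL(2, ℤ)) 1 0 = 0) ∧
      ((γ : SL(2, ℤ)) 1 0 ≠ 0 →
        ((δ : SL(2, ℤ)) 0 0 : ℚ) / ((δ : SL(2, ℤ)) 1 0 : ℚ) =
          p * (((γ : SL(2, ℤ)) 0 0 : ℚ) / ((γ : SL(2, ℤ)) 1 0 : ℚ))) ∧
      ((((δ : SL(2, ℤ)) 1 1 : ℤ) : ZMod N)) * ((((γ : SL(2, ℤ)) 0 0 : ℤ) : ZMod N)) *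
          (if (p : ℤ) ∣ (γ : SL(2, ℤ)) 1 0 then 1 else (p : ZMod N)) = 1 := by
  have hp0 : p ≠ 0 := hp.ne_zero
  have hpz : (p : ℤ) ≠ 0 := by exact_mod_cast hp0
  have hpP : Prime (p : ℤ) := Nat.prime_iff_prime_int.mp hp
  set a : ℤ := (γ : SL(2, ℤ)) 0 0
  set c : ℤ := (γ : SL(2, ℤ)) 1 0
  have hac : IsCoprime a c := Matrix.SpecialLinearGroup.isCoprime_col (γ : SL(2, ℤ)) 0
  have hNc : (N : ℤ) ∣ c := dvd_entry_of_mem_Gamma0 N γ.2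
  by_cases hdvd : (p : ℤ) ∣ c
  · obtain ⟨v, hv⟩ := hdvd
    have hav : IsCoprime a v := by
      rw [hv] at hac
      exact hac.of_mul_right_right
    have hNp : IsCoprime (N : ℤ) p := by
      rw [Nat.isCoprime_iff_coprime]
      exact (Nat.Coprime.symm ((Nat.Prime.coprime_iff_not_dvd hp).mpr hpN))
    have hNv : (N : ℤ) ∣ v := hNp.dvd_of_dvd_mul_left (by rw [← hv]; exact hNc)
    refine ⟨Gamma0.mkOfCol a v hav hNv, by simp [c, hv, hp0], fun hc ↦ ?_, ?_⟩
    · simp only [Gamma0.mkOfCol_apply_zero_zero, Gamma0.mkOfCol_apply_one_zero]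
      have hv0 : v ≠ 0 := by
        rintro rfl
        exact hc (by simpa [c] using hv)
      have hv' : (v : ℚ) ≠ 0 := by exact_mod_cast hv0
      have hp' : (p : ℚ) ≠ 0 := by exact_mod_cast hp0
      have hcv : (c : ℚ) = p * v := by exact_mod_cast hv
      rw [hcv]
      field_simp
    · rw [if_pos ⟨v, hv⟩, mul_one]
      exact mkOfCol_apply_one_one_mul_eq_one (N := N) a v hav hNv
  · have hpc : IsCoprime (p * a) c :=
      (hpP.coprime_iff_not_dvd.mpr hdvd).mul_left hac
    refine ⟨Gamma0.mkOfCol (p * a) c hpc hNc, by simp [c], fun hc ↦ ?_, ?_⟩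
    · simp only [Gamma0.mkOfCol_apply_zero_zero, Gamma0.mkOfCol_apply_one_zero]
      push_cast
      ring
    · rw [if_neg hdvd]
      have h1 := mkOfCol_apply_one_one_mul_eq_one (N := N) (p * a) c hpc hNc
      push_cast at h1
      linear_combination h1

omit hp in
/-- Counting lemma behind «`T_p = p + 1` on the Shimura quotient»: for coprime `a, c` and a prime `p`, among the
`p` residues `a + jc` (`0 ≤ j < p`) exactly one is divisible by `p` if `p ∤ c`, and none if `p ∣ c`; in product
form over a commutative monoid. [folklore] -/
theorem prod_ite_dvd_add_mul_eq {M : Type*} [CommMonoid M] (hp' : p.Prime) {a c : ℤ} (hac : IsCoprime a c)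
    (x : M) :
    (∏ j : Fin p, if (p : ℤ) ∣ a + ((j : ℕ) : ℤ) * c then x else 1) =
      if (p : ℤ) ∣ c then 1 else x := by
  haveI : Fact p.Prime := ⟨hp'⟩
  have hpP : Prime (p : ℤ) := Nat.prime_iff_prime_int.mp hp'
  by_cases hc : (p : ℤ) ∣ c
  · rw [if_pos hc]
    refine Finset.prod_eq_one fun j _ ↦ ?_
    rw [if_neg]
    intro hj
    have ha : (p : ℤ) ∣ a := by
      have : (p : ℤ) ∣ a + (j : ℕ) * c - (j : ℕ) * c := dvd_sub hj (dvd_mul_of_dvd_right hc _)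
      simpa using this
    exact hpP.not_unit (hac.isUnit_of_dvd' ha hc)
  · rw [if_neg hc]
    -- the unique index `j₀` with `p ∣ a + j₀ c`
    have hcu : ((c : ℤ) : ZMod p) ≠ 0 := by
      rwa [Ne, ZMod.intCast_zmod_eq_zero_iff_dvd]
    set j₀z : ZMod p := -((a : ℤ) : ZMod p) * ((c : ℤ) : ZMod p)⁻¹ with hj₀z
    let j₀ : Fin p := ⟨j₀z.val, ZMod.val_lt j₀z⟩
    have hcast : ∀ j : Fin p, (((j : ℕ) : ℤ) : ZMod p) = ((j : ℕ) : ZMod p) := fun j ↦ by push_cast; rfl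
    have hiff : ∀ j : Fin p, (p : ℤ) ∣ a + ((j : ℕ) : ℤ) * c ↔ j = j₀ := by
      intro j
      rw [← ZMod.intCast_zmod_eq_zero_iff_dvd]
      push_cast
      constructor
      · intro h
        have hj : ((j : ℕ) : ZMod p) = j₀z := by
          rw [hj₀z]
          have : ((j : ℕ) : ZMod p) * ((c : ℤ) : ZMod p) = -((a : ℤ) : ZMod p) := by
            linear_combination h
          calc ((j : ℕ) : ZMod p) = ((j : ℕ) : ZMod p) * ((c : ℤ) : ZMod p) * ((c : ℤ) : ZMod p)⁻¹ := by
                rw [mul_assoc, mul_inv_cancel₀ hcu, mul_one]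
            _ = _ := by rw [this]
        apply Fin.ext
        change (j : ℕ) = j₀z.val
        have := congrArg ZMod.val hj
        rwa [ZMod.val_natCast, Nat.mod_eq_of_lt j.2] at this
      · rintro rfl
        change ((a : ℤ) : ZMod p) + ((j₀z.val : ℕ) : ZMod p) * ((c : ℤ) : ZMod p) = 0
        rw [ZMod.natCast_zmod_val, hj₀z]
        field_simp
        ring
    rw [Finset.prod_ite, Finset.prod_const_one, mul_one, Finset.prod_const]
    have hcard : (Finset.univ.filter fun j : Fin p ↦ (p : ℤ) ∣ a + ((j : ℕ) : ℤ) * c).card = 1 := by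
      rw [Finset.card_eq_one]
      refine ⟨j₀, ?_⟩
      ext j
      simp only [Finset.mem_filter, Finset.mem_univ, true_and, Finset.mem_singleton]
      exact hiff j
    rw [hcard, pow_one]

/-- **The Hecke–Shimura lemma on period functionals** (Theorem (R), KEY LEMMA (d), `Γ₀(N)` form). For a prime
`p ∤ N` and `γ ∈ Γ₀(N)` there are `δ₀, …, δ_{p−1}, δ' ∈ Γ₀(N)` with
`{∞, γ∞}_{T_p h} = ∑ⱼ {∞, δⱼ∞}_h + {∞, δ'∞}_h` for EVERY `h ∈ S₂(Γ₀(N))` (the tree's `exists_cuspSymbol_heckeT`,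
Cremona (2.4.1)–(2.4.2)) AND `∏ⱼ d(δⱼ) · d(δ') = d(γ)^{p+1}` in `ZMod N` (`d` = lower-right entry): the `p + 1`
translates have lower-right entries `d(γ)` (`p − 1` or `p + 1` times) and, when `p ∤ c`, `p·d(γ)` and
`p⁻¹·d(γ)` once each — so every character `ψ ∘ d` of `Γ₀(N)` (`ψ` a character of `(ℤ/N)^×`) is `T_p`-Eisenstein:
`(ψ∘d)(T_p[γ]) = (p + 1)·(ψ∘d)[γ]` («`T_p = p + 1` on the Shimura subgroup», Ling–Oesterlé Thm 6 for `p ∤ N`,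
Mazur II.11.7). [cite: LingOesterle1991, Thm. 6 (p ∤ N half, character form)] [cite: CremonaAlgorithms1997, §2.4 (2.4.1)–(2.4.2)] -/
theorem exists_cuspSymbol_heckeT_lowerRight [NeZero N] [NeZero p] (hpN : ¬ p ∣ N) (γ : Gamma0 N) :
    ∃ (δ : Fin p → Gamma0 N) (δ' : Gamma0 N),
      (∀ h : CuspForm (Gamma0 N) 2,
        cuspSymbol (heckeT (Gamma0 N) 2 p h) γ = ∑ j : Fin p, cuspSymbol h (δ j) + cuspSymbol h δ') ∧
      (∏ j : Fin p, ((((δ j : SL(2, ℤ)) 1 1 : ℤ) : ZMod N))) * ((((δ' : SL(2, ℤ)) 1 1 : ℤ) : ZMod N)) =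
        ((((γ : SL(2, ℤ)) 1 1 : ℤ) : ZMod N)) ^ (p + 1) := by
  choose δ hδ0 hδ hδd using fun j : Fin p ↦ exists_gamma0_inftyImage_tpB_lowerRight (N := N) hp γ ((j : ℕ) : ℤ)
  obtain ⟨δ', hδ'0, hδ', hδ'd⟩ := exists_gamma0_inftyImage_tpD_lowerRight (N := N) hp hpN γ
  have key : ∀ h : CuspForm (Gamma0 N) 2, (γ : SL(2, ℤ)) 1 0 ≠ 0 →
      ∑ j : Fin p, modularSymbol h
          ((((γ : SL(2, ℤ)) 0 0 : ℚ) / ((γ : SL(2, ℤ)) 1 0 : ℚ) + ((j : ℕ) : ℤ)) / p) =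
        ∑ j : Fin p, cuspSymbol h (δ j) := by
    intro h hc
    refine Finset.sum_congr rfl fun j _ ↦ ?_
    rw [cuspSymbol, if_neg (fun h0 ↦ hc ((hδ0 j).mp h0)), hδ j hc]
  refine ⟨δ, δ', fun h ↦ ?_, ?_⟩
  · by_cases hc : (γ : SL(2, ℤ)) 1 0 = 0
    · rw [cuspSymbol, if_pos hc, cuspSymbol, if_pos (hδ'0.mpr hc), add_zero]
      symm
      exact Finset.sum_eq_zero fun j _ ↦ by rw [cuspSymbol, if_pos ((hδ0 j).mpr hc)]
    · rw [cuspSymbol, if_neg hc, modularSymbol_heckeT_eq_sum p h hp, if_neg hpN,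
        cuspSymbol, if_neg (fun h0 ↦ hc (hδ'0.mp h0)), hδ' hc, key h hc]
  · -- the lower-right entries: multiply both sides by the unit `a^{p+1} · ε`, `ε ∈ {1, p}`
    set A : ZMod N := (((γ : SL(2, ℤ)) 0 0 : ℤ) : ZMod N) with hA
    set D : ZMod N := (((γ : SL(2, ℤ)) 1 1 : ℤ) : ZMod N) with hD
    set ε : ZMod N := if (p : ℤ) ∣ (γ : SL(2, ℤ)) 1 0 then 1 else (p : ZMod N) with hε
    have hDA : D * A = 1 := gamma0_apply_one_one_mul_apply_zero_zero γ
    have hac : IsCoprime ((γ : SL(2, ℤ)) 0 0) ((γ : SL(2, ℤ)) 1 0) :=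
      Matrix.SpecialLinearGroup.isCoprime_col (γ : SL(2, ℤ)) 0
    have hprod : (∏ j : Fin p, ((((δ j : SL(2, ℤ)) 1 1 : ℤ) : ZMod N)) * A) = ε := by
      rw [Finset.prod_congr rfl fun j _ ↦ hδd j]
      exact prod_ite_dvd_add_mul_eq hp hac (p : ZMod N)
    have hpu : IsUnit (p : ZMod N) := by
      rw [ZMod.isUnit_iff_coprime]
      exact (Nat.Prime.coprime_iff_not_dvd hp).mpr hpN
    have hεu : IsUnit ε := by
      rw [hε]
      split_ifs
      · exact isUnit_one
      · exact hpu
    have hAu : IsUnit A := IsUnit.of_mul_eq_one_right _ hDA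
    have hunit : IsUnit (A ^ (p + 1) * ε) := (hAu.pow _).mul hεu
    refine hunit.mul_left_injective ?_
    have lhs : (∏ j : Fin p, ((((δ j : SL(2, ℤ)) 1 1 : ℤ) : ZMod N))) *
        ((((δ' : SL(2, ℤ)) 1 1 : ℤ) : ZMod N)) * (A ^ (p + 1) * ε) =
        (∏ j : Fin p, ((((δ j : SL(2, ℤ)) 1 1 : ℤ) : ZMod N)) * A) *
          (((((δ' : SL(2, ℤ)) 1 1 : ℤ) : ZMod N)) * A * ε) := by
      rw [Finset.prod_mul_distrib, Finset.prod_const, Finset.card_univ, Fintype.card_fin]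
      ring
    have rhs : D ^ (p + 1) * (A ^ (p + 1) * ε) = ε := by
      rw [← mul_assoc, ← mul_pow, hDA, one_pow, one_mul]
    change (∏ j : Fin p, ((((δ j : SL(2, ℤ)) 1 1 : ℤ) : ZMod N))) *
        ((((δ' : SL(2, ℤ)) 1 1 : ℤ) : ZMod N)) * (A ^ (p + 1) * ε) = D ^ (p + 1) * (A ^ (p + 1) * ε)
    rw [lhs, rhs, hprod, hδ'd, mul_one]

end HeckeShimura

end Summit.BirchSwinnertonDyer.BirchSwinnertonDyer.Theorems.SignedMuAtTwo

end
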